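import Literature.Analysis.FluidPDE.TaoForcedUniquenessEnstrophyInequality
import Literature.Analysis.FluidPDE.TaoAnnulusAssembly
import HarnessLib

/-!
# Tao (2011/2013), Thm. 10.1 WITH FORCE (a priori form, unit viscosity): enstrophy localisation
# for annuli and for exterior regions, keeping the hypothesis `‖∇ × f‖_{L¹_t L²_x} ≤ δ` of (10.1)

Cell `pub/ns-blowup`, seat `ns-blowup-lean2` (PATH A of the E–C route's Literature leaf W14 =
`tao2011_forced_unconditionalUniqueness_velocity`, Tao 2011 Cor. 11.4 = arXiv Cor. 71 WITH force).
WHAT THIS IS NOT: not a statement about Navier–Stokes blow-up — the forced twin of a proved brick of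
the tree's `f = 0` formalisation of T. Tao, arXiv:1108.1165, §10.

Thm. 10.1 (= arXiv Thm. 59, p. 30) is printed WITH force: "Let `(u,p,u₀,f,T)` be a finite energy
almost smooth solution. Let `B(x₀,R)` be a ball such that
`‖ω₀‖_{L²_x(B(x₀,R))} + ‖∇ × f‖_{L¹_t L²_x([0,T] × B(x₀,R))} ≤ δ` (10.1) … Then
`‖ω‖_{L^∞_t L²_x([0,T] × B(x₀,R−r))} + ‖∇ω‖_{L²_t L²_x([0,T] × B(x₀,R−r))} ≲ δ`", and Remark 10.6
(arXiv Rem. 64) adapts it to annuli and, "sending `R'` to infinity", to exterior regions. The tree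
proves the a priori forms (the two global inputs Lemma 8.1 and Prop. 9.1 made hypotheses
`sup_t ∫|u|² ≤ 2E`, `∫₀ᵀ∫|∇u|² ≤ E`, `∫₀ᵀ‖u‖_{L^∞} ≤ M`, and (10.3) read as `r > C(E + M + δ⁻²)`)
for `f = 0` only: `tao2011_enstrophyLocalisation_annulus_apriori_unit_of_nonlinearEstimate`
(`TaoAnnulusAssembly.lean`) and `tao2011_enstrophyLocalisation_exterior_apriori_unit_of_annulus`
(`TaoEnstrophyLocalisationAnnulus.lean`). This file proves the same two statements for the FORCED
unit-viscosity system, with the force half of (10.1) as the extra hypothesis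

  `∫₀ᵀ ‖∇ × f(t)‖_{L²(region)} dt ≤ δ`   (lower Lebesgue integrals, `region` = the annulus
  `B(x₀,R₂) ∖ B(x₀,R₁)`, resp. the exterior region `ℝ³ ∖ B(x₀,R)`):

* `intervalIntegral_forceRate_le` — the budget `∫₀ᵀ a ≤ √2 δ` of the real force rate
  `a(t) = √2‖∇ × f(t)‖_{L²({R₁'<|x−x₀|<R₂'})}` on any sub-annulus;
* `enstrophyLocalisation_annulus_apriori_unit_forced` — Thm. 10.1 for annuli, a priori form,
  `ν = 1`, WITH force, from the nonlinear estimate `tao2011_nonlinearEstimate` (a theorem of the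
  tree, `tao2011_nonlinearEstimate_holds`; kept as a hypothesis here exactly as in the `f = 0`
  assembly, to keep the import closure light): the §10 argument of `TaoAnnulusAssembly.lean` run
  verbatim on the forced integrated inequality `localisedEnstrophy_add_intervalIntegral_le_forced`,
  the continuity step `tao2011_enstrophy_continuity_step_integral` now being fed Tao's `a(t)` with
  `∫₀ᵀ a ≤ K₁δ` (`K₁ = max K 2 ≥ √2`) instead of `a = 0`; constants as there
  (`c = min(c₀(K₁), ½, (2K₁)^{-10/9})`, `C = max(8/c, 9c^{-1/10}(‖curl‖² + 1))`,
  `A² = 18K₁³e^{2K₁}c^{-1/200}`);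
* `enstrophyLocalisation_exterior_apriori_unit_forced` — the exterior form, by monotone
  convergence over the exhausting annuli `B(x₀,R+r+n+1) ∖ B(x₀,R+r)` (Remark 10.6), as in the tree.

Everything is proved; no definition and no named fact is introduced (D-0026).

## Mathlib / tree search

Tree: the `f = 0` statements/proofs named above; force-general bricks `TaoLocalisedEnstrophy`,
`TaoAnnulusHeatFlux` (pigeonhole `exists_radius_intervalIntegral_sphereTerm(_sub)_le`, heat-flux
budget), `TaoEnstrophyContinuity`, `aemeasurable_setLIntegral_fderiv_curl`
(`TaoEnstrophyLocalisationAnnulus`). `lean search 'apriori_unit_forced' --decl`: nothing prior.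

## References

* T. Tao, *Localisation and compactness properties of the Navier–Stokes global regularity
  problem*, Anal. PDE 6 (2013) 25–107 = arXiv:1108.1165 (`Tao2011`): Thm. 10.1 and its proof
  (arXiv Thm. 59, §10, pp. 30–33, (10.1)–(10.23)), Remark 10.6 (arXiv Rem. 64, p. 33).
-/

noncomputable section

open MeasureTheory Set Function Filter intervalIntegral
open scoped ENNReal NNReal Topology RealInnerProductSpace ContDiff

namespace Literature.Analysis.FluidPDE

/-! ## From the `L¹_t L²_x` budget of `∇ × f` to the real force rate -/

section RateBudget

/-- **The budget of the force rate** ("Note from (10.1) that `∫₀ᵀ a(t) dt ≲ δ`", arXiv p. 31): if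
`∫₀ᵀ ‖∇ × f(t)‖_{L²(B(x₀,R₂) ∖ B(x₀,R₁))} dt ≤ δ` (lower Lebesgue integrals) then, for radii
`R₁ ≤ R₁'`, `R₂' ≤ R₂`, the real force rate `a(t) = √2‖∇ × f(t)‖_{L²({R₁'<|x−x₀|<R₂'})}` has
`∫₀ᵀ a ≤ √2 δ`. [cite: Tao2011, §10, proof of Thm. 10.1 ((10.1) and the bound ∫a ≲ δ)] -/
theorem intervalIntegral_forceRate_le {T : ℝ} (hT : 0 < T)
    {f : ℝ → EuclideanSpace ℝ (Fin 3) → EuclideanSpace ℝ (Fin 3)}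
    (hf : FluidPDE.IsSmoothSpaceTimeOn (Icc 0 T) f) (x₀ : EuclideanSpace ℝ (Fin 3))
    {δ R₁ R₂ R₁' R₂' : ℝ} (hδ : 0 ≤ δ) (hR₁' : 0 ≤ R₁') (hR₁ : R₁ ≤ R₁') (hR₂ : R₂' ≤ R₂)
    (hF : ∫⁻ t in Ioo 0 T, (∫⁻ x in Metric.ball x₀ R₂ \ Metric.ball x₀ R₁,
        ‖FluidPDE.curl (f t) x‖ₑ ^ 2) ^ (1 / 2 : ℝ) ≤ ENNReal.ofReal δ) :
    ∫ t in (0)..T, Real.sqrt 2 * Real.sqrt (∫ x in {x : EuclideanSpace ℝ (Fin 3) |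
      R₁' < ‖x - x₀‖ ∧ ‖x - x₀‖ < R₂'}, ‖FluidPDE.curl (f t) x‖ ^ 2) ≤ Real.sqrt 2 * δ := by
  set S : Set (EuclideanSpace ℝ (Fin 3)) := {x | R₁' < ‖x - x₀‖ ∧ ‖x - x₀‖ < R₂'} with hSdef
  have hS : MeasurableSet S := measurableSet_shell_centre x₀ R₁' R₂'
  have hSsub : S ⊆ Metric.ball x₀ R₂ \ Metric.ball x₀ R₁ := fun x hx => by
    rw [Set.mem_sdiff, Metric.mem_ball, Metric.mem_ball, dist_eq_norm, not_lt]
    exact ⟨hx.2.trans_le hR₂, hR₁.trans hx.1.le⟩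
  -- the real rate `a₀(t) = √(∫_S |curl f(t)|²)` is continuous and nonnegative on `[0, T]`
  set a₀ : ℝ → ℝ := fun t => Real.sqrt (∫ x in S, ‖FluidPDE.curl (f t) x‖ ^ 2) with ha₀def
  have hac : ContinuousOn a₀ (Icc 0 T) :=
    (continuousOn_setIntegral_shell_curl_sq hT hf x₀ (b := R₂') hR₁').sqrt
  have ha0 : ∀ t, 0 ≤ a₀ t := fun t => Real.sqrt_nonneg _
  have hai : IntegrableOn a₀ (Ioc 0 T) volume :=
    (hac.integrableOn_compact isCompact_Icc).mono_set Ioc_subset_Icc_self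
  rw [intervalIntegral.integral_const_mul]
  refine mul_le_mul_of_nonneg_left ?_ (Real.sqrt_nonneg 2)
  rw [intervalIntegral.integral_of_le hT.le]
  -- pointwise comparison with the `ℝ≥0∞` rate on the big shell
  have hpt : ∀ t ∈ Icc 0 T, ENNReal.ofReal (a₀ t) ≤
      (∫⁻ x in Metric.ball x₀ R₂ \ Metric.ball x₀ R₁, ‖FluidPDE.curl (f t) x‖ₑ ^ 2) ^ (1 / 2 : ℝ) := by
    intro t ht
    have hcf : Continuous (FluidPDE.curl (f t)) :=
      FluidPDE.continuous_curl ((hf.contDiff_slice ht).of_le (by norm_cast))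
    have hgS : IntegrableOn (fun x => ‖FluidPDE.curl (f t) x‖ ^ 2) S volume :=
      (((hcf.norm.pow 2).continuousOn).integrableOn_compact
        (isCompact_closedBall x₀ R₂')).mono_set fun x hx => by
          rw [Metric.mem_closedBall, dist_eq_norm]; exact hx.2.le
    have hI0 : 0 ≤ ∫ x in S, ‖FluidPDE.curl (f t) x‖ ^ 2 := setIntegral_nonneg hS fun x _ => sq_nonneg _
    have e1 : ENNReal.ofReal (a₀ t) = (ENNReal.ofReal (∫ x in S, ‖FluidPDE.curl (f t) x‖ ^ 2)) ^ (1 / 2 : ℝ) := by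
      rw [ha₀def]
      simp only []
      rw [Real.sqrt_eq_rpow, ENNReal.ofReal_rpow_of_nonneg hI0 (by norm_num)]
    have e2 : ENNReal.ofReal (∫ x in S, ‖FluidPDE.curl (f t) x‖ ^ 2) =
        ∫⁻ x in S, ‖FluidPDE.curl (f t) x‖ₑ ^ 2 := by
      rw [ofReal_integral_eq_lintegral_ofReal hgS (ae_of_all _ fun x => sq_nonneg _)]
      refine lintegral_congr fun x => ?_
      rw [← ofReal_norm, ENNReal.ofReal_pow (norm_nonneg _)]
    rw [e1, e2]
    exact ENNReal.rpow_le_rpow (lintegral_mono_set hSsub) (by norm_num)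
  have key : ENNReal.ofReal (∫ t in Ioc 0 T, a₀ t) ≤ ENNReal.ofReal δ := by
    rw [ofReal_integral_eq_lintegral_ofReal hai (ae_of_all _ fun t => ha0 t),
      setLIntegral_congr Ioo_ae_eq_Ioc.symm]
    refine le_trans (setLIntegral_mono' measurableSet_Ioo fun t ht => hpt t (Ioo_subset_Icc_self ht)) hF
  exact (ENNReal.ofReal_le_ofReal_iff hδ).1 key

end RateBudget

/-! ## Thm. 10.1 for annuli, a priori form, unit viscosity, WITH FORCE -/

section Assembly

-- The §10 assembly is one long bookkeeping proof (constants, radii, pigeonhole, continuity method,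
-- extraction: ~270 tactic lines); like its `f = 0` twin it elaborates within 8× the default budget.
set_option maxHeartbeats 1600000 in
/-- **Tao 2011, Thm. 10.1 for annuli (Remark 10.6), a priori form, unit viscosity, WITH FORCE —
from the nonlinear estimate.** For a classical solution of the forced `ν = 1` system on the closed
slab `[0,T] × ℝ³` with `sup_t ∫|u|² ≤ 2E`, `∫₀ᵀ∫|∇u|²_F ≤ E`, `∫₀ᵀ‖u‖_{L^∞} ≤ M`, an annulus
`B(x₀,R₂) ∖ B(x₀,R₁)` carrying initial enstrophy `≤ δ²` and force budget
`∫₀ᵀ‖∇ × f(t)‖_{L²(B(x₀,R₂) ∖ B(x₀,R₁))} dt ≤ δ` ((10.1)), under the smallness (10.2)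
`δ⁴T + δ⁵E^{1/2}T ≤ c` and the largeness `C(E + M + δ⁻²) < r` (`r < R₁/2`, `r < (R₂−R₁)/2`):
`sup_t ‖ω(t)‖²_{L²}` and `∫₀ᵀ‖∇ω‖²_{L²}` on the shrunken annulus `B(x₀,R₂−r) ∖ B(x₀,R₁+r)` are
`≤ (Aδ)²`. The §10 argument of the tree's `f = 0` assembly
(`tao2011_enstrophyLocalisation_annulus_apriori_unit_of_nonlinearEstimate`) run on the forced
integrated inequality `localisedEnstrophy_add_intervalIntegral_le_forced`; the continuity step
`tao2011_enstrophy_continuity_step_integral` is fed Tao's force rate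
`a(t) = √2‖∇ × f(t)‖_{L²({R₁'<|x−x₀|<R₂'})}` with `∫₀ᵀ a ≤ √2δ ≤ K₁δ`, `K₁ = max K 2`.
[cite: Tao2011, Thm. 10.1 + Remark 10.6 (proof, §10, arXiv pp. 30–33)] -/
theorem enstrophyLocalisation_annulus_apriori_unit_forced (hY : tao2011_nonlinearEstimate) :
    ∃ c C A : ℝ, 0 < c ∧ 0 < C ∧ 0 < A ∧
    ∀ ⦃T : ℝ⦄ (_hT : 0 < T) ⦃f u : ℝ → EuclideanSpace ℝ (Fin 3) → EuclideanSpace ℝ (Fin 3)⦄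
      ⦃p : ℝ → EuclideanSpace ℝ (Fin 3) → ℝ⦄
      (_hsol : FluidPDE.IsClassicalNSSolutionOn (Icc 0 T) 1 f u p)
      ⦃E M : ℝ⦄ (_hE : 0 ≤ E) (_hM : 0 ≤ M)
      (_hEt : ∀ t ∈ Icc 0 T, ∫⁻ x, ‖u t x‖ₑ ^ 2 ≤ ENNReal.ofReal (2 * E))
      (_hD : ENNReal.ofReal 1 *
          ∫⁻ t in Ioo 0 T, ∫⁻ x, ENNReal.ofReal (FluidPDE.frobeniusNormSq (fderiv ℝ (u t) x)) ≤
        ENNReal.ofReal E)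
      (_hMt : ∫⁻ t in Ioo 0 T, eLpNorm (u t) ∞ volume ≤ ENNReal.ofReal M)
      (x₀ : EuclideanSpace ℝ (Fin 3)) ⦃R₁ R₂ r δ : ℝ⦄ (_hδ : 0 < δ) (_hr : 0 < r) (_hrR₁ : r < R₁ / 2)
      (_hrR₂ : r < (R₂ - R₁) / 2)
      (_hω₀ : ∫⁻ x in Metric.ball x₀ R₂ \ Metric.ball x₀ R₁, ‖FluidPDE.curl (u 0) x‖ₑ ^ 2 ≤
        ENNReal.ofReal (δ ^ 2))
      (_hF : ∫⁻ t in Ioo 0 T, (∫⁻ x in Metric.ball x₀ R₂ \ Metric.ball x₀ R₁,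
          ‖FluidPDE.curl (f t) x‖ₑ ^ 2) ^ (1 / 2 : ℝ) ≤ ENNReal.ofReal δ)
      (_hsmall : δ ^ 4 * T + δ ^ 5 * Real.sqrt E * T ≤ c)
      (_hlarge : C * (E + M + δ⁻¹ ^ 2) < r),
      (∀ t ∈ Icc 0 T, ∫⁻ x in Metric.ball x₀ (R₂ - r) \ Metric.ball x₀ (R₁ + r),
          ‖FluidPDE.curl (u t) x‖ₑ ^ 2 ≤ ENNReal.ofReal ((A * δ) ^ 2)) ∧
        ∫⁻ t in Ioo 0 T, ∫⁻ x in Metric.ball x₀ (R₂ - r) \ Metric.ball x₀ (R₁ + r),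
            ‖fderiv ℝ (FluidPDE.curl (u t)) x‖ₑ ^ 2 ≤ ENNReal.ofReal ((A * δ) ^ 2) := by
  obtain ⟨K, -, hYK⟩ := hY
  set K₁ : ℝ := max K 2 with hK₁def
  have hK₁2 : 2 ≤ K₁ := le_max_right _ _
  have hK₁ : 1 ≤ K₁ := le_trans (by norm_num) hK₁2
  have hK₁0 : 0 < K₁ := one_pos.trans_le hK₁
  have hY₁ : tao2011_nonlinearEstimateWith K₁ := hYK.mono (le_max_left _ _)
  obtain ⟨c₀, hc₀, -, hstep⟩ := tao2011_enstrophy_continuity_step_integral hK₁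
  set c : ℝ := min c₀ (min (1 / 2) ((2 * K₁) ^ (-(10 / 9 : ℝ)))) with hcdef
  have hc : 0 < c := lt_min hc₀ (lt_min (by norm_num) (Real.rpow_pos_of_pos (by linarith) _))
  have hcc₀ : c ≤ c₀ := min_le_left _ _
  have hc12 : c ≤ 1 / 2 := (min_le_right _ _).trans (min_le_left _ _)
  have hc1 : c ≤ 1 := by linarith
  have hcK : c ≤ (2 * K₁) ^ (-(10 / 9 : ℝ)) := (min_le_right _ _).trans (min_le_right _ _)
  have habs : c + K₁ * c ^ (9 / 10 : ℝ) ≤ 1 := by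
    have := mul_rpow_nine_tenths_le_half hK₁ hc hcK; linarith
  set κ2 : ℝ := ‖FluidPDE.curlCLM‖ ^ 2 with hκ2def
  have hκ2 : 0 ≤ κ2 := sq_nonneg _
  set C : ℝ := max (8 / c) (9 * c ^ (-(1 / 10 : ℝ)) * (κ2 + 1)) with hCdef
  have hC8c : 8 / c ≤ C := le_max_left _ _
  have hC9 : 9 * c ^ (-(1 / 10 : ℝ)) * (κ2 + 1) ≤ C := le_max_right _ _
  have hC0 : 0 < C := lt_of_lt_of_le (by positivity) hC8c
  set L : ℝ := 18 * K₁ ^ 3 * Real.exp (2 * K₁) * c ^ (-(1 / 200 : ℝ)) with hLdef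
  have hL0 : 0 < L := by positivity
  have hL6 : 2 * (3 * K₁ ^ 2 * Real.exp (2 * K₁) * c ^ (-(1 / 200 : ℝ))) ≤ L := by
    rw [hLdef]
    have h1 : K₁ ^ 2 ≤ K₁ ^ 3 := by nlinarith
    have h2 : 0 ≤ Real.exp (2 * K₁) * c ^ (-(1 / 200 : ℝ)) := by positivity
    nlinarith
  set A : ℝ := Real.sqrt L with hAdef
  have hA0 : 0 < A := Real.sqrt_pos.2 hL0
  have hA2 : ∀ δ : ℝ, (A * δ) ^ 2 = L * δ ^ 2 := fun δ => by
    rw [mul_pow, hAdef, Real.sq_sqrt hL0.le]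
  refine ⟨c, C, A, hc, hC0, hA0, ?_⟩
  intro T hT f u p hsol E M hE hM hEt hD hMt x₀ R₁ R₂ r δ hδ hr hrR₁ hrR₂ hω₀ hF hsmall hlarge
  have hu := hsol.smooth_velocity
  -- the slope `k = c^{-1/10} δ²` and the width `k⁻¹ = c^{1/10} δ⁻² ≤ δ⁻²`
  set k : ℝ := c ^ (-(1 / 10 : ℝ)) * δ ^ 2 with hk
  have hk0 : 0 < k := by positivity
  have hki : 0 < k⁻¹ := inv_pos.2 hk0
  have hkinv : k⁻¹ ≤ δ⁻¹ ^ 2 := by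
    rw [hk, mul_inv, Real.rpow_neg hc.le, inv_inv, inv_pow]
    have h1 : c ^ (1 / 10 : ℝ) ≤ 1 := Real.rpow_le_one hc.le hc1 (by norm_num)
    have h2 : 0 ≤ (δ ^ 2)⁻¹ := by positivity
    calc c ^ (1 / 10 : ℝ) * (δ ^ 2)⁻¹ ≤ 1 * (δ ^ 2)⁻¹ := mul_le_mul_of_nonneg_right h1 h2
      _ = (δ ^ 2)⁻¹ := one_mul _
  -- consequences of (10.3): `M/c < r/8`, `k⁻¹ < r/8`, `9 c^{-1/10} κ² E < r`
  have hδ2 : 0 ≤ δ⁻¹ ^ 2 := by positivity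
  have hCM : C * M < r :=
    (mul_le_mul_of_nonneg_left (by linarith only [hE, hδ2]) hC0.le).trans_lt hlarge
  have hCE : C * E < r :=
    (mul_le_mul_of_nonneg_left (by linarith only [hM, hδ2]) hC0.le).trans_lt hlarge
  have hCδ : C * δ⁻¹ ^ 2 < r :=
    (mul_le_mul_of_nonneg_left (by linarith only [hM, hE]) hC0.le).trans_lt hlarge
  have hMr : M / c < r / 8 := by
    have h1 : 8 / c * M ≤ C * M := mul_le_mul_of_nonneg_right hC8c hM
    rw [div_mul_eq_mul_div] at h1
    rw [div_lt_div_iff₀ hc (by norm_num : (0:ℝ) < 8)]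
    have h2 : 8 * M / c < r := h1.trans_lt hCM
    rw [div_lt_iff₀ hc] at h2
    linarith
  have hℓr : k⁻¹ < r / 8 := by
    have h1c : 1 ≤ 1 / c := by rw [le_div_iff₀ hc]; linarith
    have h1 : 8 * k⁻¹ ≤ 8 / c * δ⁻¹ ^ 2 := by
      calc 8 * k⁻¹ ≤ 8 * δ⁻¹ ^ 2 := by linarith
        _ = 8 * 1 * δ⁻¹ ^ 2 := by ring
        _ ≤ 8 * (1 / c) * δ⁻¹ ^ 2 := by gcongr
        _ = 8 / c * δ⁻¹ ^ 2 := by ring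
    have h2 : 8 / c * δ⁻¹ ^ 2 ≤ C * δ⁻¹ ^ 2 := mul_le_mul_of_nonneg_right hC8c hδ2
    linarith
  have hEr : 9 * c ^ (-(1 / 10 : ℝ)) * κ2 * E < r := by
    have h1 : 9 * c ^ (-(1 / 10 : ℝ)) * κ2 * E ≤ 9 * c ^ (-(1 / 10 : ℝ)) * (κ2 + 1) * E := by
      have : 0 ≤ 9 * c ^ (-(1 / 10 : ℝ)) * E := by positivity
      nlinarith
    have h2 : 9 * c ^ (-(1 / 10 : ℝ)) * (κ2 + 1) * E ≤ C * E := mul_le_mul_of_nonneg_right hC9 hE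
    linarith
  -- dissipation in the form without the unit viscosity factor, and (10.2)
  have hD' : ∫⁻ t in Ioo 0 T, ∫⁻ x, ENNReal.ofReal (FluidPDE.frobeniusNormSq (fderiv ℝ (u t) x)) ≤
      ENNReal.ofReal E := by rwa [ENNReal.ofReal_one, one_mul] at hD
  have hsmallE : δ ^ 5 * Real.sqrt E * T ≤ c := by
    have : 0 ≤ δ ^ 4 * T := by positivity
    linarith
  have hδ4T : δ ^ 4 * T ≤ c := by
    have : 0 ≤ δ ^ 5 * Real.sqrt E * T := by positivity
    linarith
  -- the speed integral
  have hσ0 : ∀ s ∈ Icc 0 T, 0 ≤ speedIntegral u s := fun s hs => speedIntegral_nonneg hT hu hMt hs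
  have hσM : ∀ s ∈ Icc 0 T, speedIntegral u s ≤ M := fun s hs => speedIntegral_le_of_mem hT hM hu hMt hs
  have hσc : ContinuousOn (fun τ => speedIntegral u τ / c) (Icc 0 T) :=
    (continuousOn_speedIntegral hT hu hMt).div_const c
  have hσcM : ∀ s ∈ Icc 0 T, speedIntegral u s / c ≤ M / c := fun s hs =>
    div_le_div_of_nonneg_right (hσM s hs) hc.le
  have hσc0 : ∀ s ∈ Icc 0 T, 0 ≤ speedIntegral u s / c := fun s hs => div_nonneg (hσ0 s hs) hc.le
  have hσ00 : speedIntegral u 0 = 0 := by rw [speedIntegral_def, intervalIntegral.integral_same]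
  -- geometry of the radii
  have hR₁0 : 0 < R₁ := by linarith
  have hR₂R₁ : R₁ + 2 * r < R₂ := by linarith
  -- pigeonhole choice of the two radii
  set ε : ℝ := K₁ * δ ^ 2 / (4 * k) with hεdef
  have hε : 0 < ε := by positivity
  obtain ⟨R₁', hR₁'mem, hT₁⟩ := exists_radius_intervalIntegral_sphereTerm_le hT hu hE hD' x₀ hσc
    (α := R₁) (β := R₁ + r / 4) (by linarith) (fun τ hτ => by linarith [hσc0 τ hτ]) hε
  obtain ⟨R₂', hR₂'mem, hT₂⟩ := exists_radius_intervalIntegral_sphereTerm_sub_le hT hu hE hD' x₀ hσc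
    (α := R₂ - r / 4) (β := R₂) (by linarith) (fun τ hτ => by linarith [hσcM τ hτ]) hε
  rw [show R₁ + r / 4 - R₁ = r / 4 by ring] at hT₁
  rw [show R₂ - (R₂ - r / 4) = r / 4 by ring] at hT₂
  have hR₁' : 0 < R₁' := hR₁0.trans_le hR₁'mem.1
  have hgap : R₁' + M / c + 2 * k⁻¹ < R₂' - M / c := by
    linarith [hR₁'mem.2, hR₂'mem.1]
  -- the integrated enstrophy inequality along the moving cutoff
  have hineq := fun t (ht : t ∈ Icc 0 T) => localisedEnstrophy_add_intervalIntegral_le_forced hT hsol hK₁ hc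
    hc1 hδ hE hM hk habs hY₁ hsmallE hEt hMt x₀ hR₁' hgap ht
  -- continuity of W, Y₁, b on [0, T]
  obtain ⟨hρ₁c, hρ₂c⟩ := continuousOn_speedRadii hT hu hMt c R₁' R₂'
  have hρ₂le : ∀ s ∈ Icc 0 T, R₂' - speedIntegral u s / c ≤ R₂' := fun s hs => by
    linarith [hσc0 s hs]
  have hWc := continuousOn_localisedEnstrophy_movingCutoff (x₀ := x₀) hT hsol hk0.le hρ₁c hρ₂c hρ₂le
  have hYc := continuousOn_localisedEnstrophyDissipation_movingCutoff (x₀ := x₀) hT hsol hk0.le hρ₁c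
    hρ₂c hρ₂le
  have hbc := continuousOn_heatFluxMajorant_of_smooth (k := k) (c := c) (R₂' := R₂') hT hu hMt x₀ hR₁'.le
  -- the force rate `a(t) = √2 ‖curl f(t)‖_{L²(R₁' < |x - x₀| < R₂')}`: continuity, sign, budget
  have hfsm : FluidPDE.IsSmoothSpaceTimeOn (Icc 0 T) f :=
    hsol.isSmoothSpaceTimeOn_force (uniqueDiffOn_Icc hT)
  have hac := continuousOn_forceRate hT hfsm x₀ (R₁' := R₁') (R₂' := R₂') hR₁'.le
  have ha0' : ∀ t ∈ Icc 0 T, 0 ≤ (fun s => Real.sqrt 2 * Real.sqrt (∫ x in {x : EuclideanSpace ℝ (Fin 3) |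
      R₁' < ‖x - x₀‖ ∧ ‖x - x₀‖ < R₂'}, ‖FluidPDE.curl (f s) x‖ ^ 2)) t := fun t _ =>
    forceRate_nonneg f x₀ R₁' R₂' t
  have hIa : ∫ t in (0)..T, (fun s => Real.sqrt 2 * Real.sqrt (∫ x in {x : EuclideanSpace ℝ (Fin 3) |
      R₁' < ‖x - x₀‖ ∧ ‖x - x₀‖ < R₂'}, ‖FluidPDE.curl (f s) x‖ ^ 2)) t ≤ K₁ * δ := by
    have h1 := intervalIntegral_forceRate_le hT hfsm x₀ hδ.le (hR₁0.le.trans hR₁'mem.1) hR₁'mem.1 hR₂'mem.2 hF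
    have h2 : Real.sqrt 2 * δ ≤ K₁ * δ := by
      refine mul_le_mul_of_nonneg_right ?_ hδ.le
      have hs2 : Real.sqrt 2 ≤ 2 := by
        rw [show (2 : ℝ) = Real.sqrt 4 by rw [show (4:ℝ) = 2 ^ 2 by norm_num, Real.sqrt_sq (by norm_num : (0:ℝ) ≤ 2)]]
        exact Real.sqrt_le_sqrt (by norm_num)
      exact hs2.trans hK₁2
    exact h1.trans h2
  -- nonnegativity
  have hW0' : ∀ t ∈ Icc 0 T, 0 ≤ (fun s => localisedEnstrophy (movingCutoff x₀ k (fun t => R₁' + speedIntegral u t / c) (fun t => R₂' - speedIntegral u t / c) s) (u s)) t := fun t _ =>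
    localisedEnstrophy_nonneg (movingCutoff_nonneg x₀ k _ _ t) _
  have hY0' : ∀ t ∈ Icc 0 T, 0 ≤ (fun s => localisedEnstrophyDissipation (movingCutoff x₀ k (fun t => R₁' + speedIntegral u t / c) (fun t => R₂' - speedIntegral u t / c) s) (u s)) t := fun t _ =>
    localisedEnstrophyDissipation_nonneg (movingCutoff_nonneg x₀ k _ _ t) _
  have hshell0 : ∀ t, 0 ≤ ∫ x in {x : EuclideanSpace ℝ (Fin 3) | R₁' < ‖x - x₀‖ ∧ ‖x - x₀‖ < R₂'},
      ‖FluidPDE.curl (u t) x‖ ^ 2 := fun t =>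
    setIntegral_nonneg (measurableSet_shell_centre x₀ _ _) fun x _ => sq_nonneg _
  have hb0' : ∀ t ∈ Icc 0 T, 0 ≤ (fun s => k / 2 * ((R₁' + speedIntegral u s / c) ^ 2 *
            sphereNormSq (FluidPDE.curl (u s)) x₀ (R₁' + speedIntegral u s / c) +
            (R₂' - speedIntegral u s / c) ^ 2 *
              sphereNormSq (FluidPDE.curl (u s)) x₀ (R₂' - speedIntegral u s / c)) +
          k / R₁' * ∫ x in {x : EuclideanSpace ℝ (Fin 3) | R₁' < ‖x - x₀‖ ∧ ‖x - x₀‖ < R₂'},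
            ‖FluidPDE.curl (u s) x‖ ^ 2) t := fun t _ => by
    have h1 := hshell0 t
    have h2 := sphereNormSq_nonneg (FluidPDE.curl (u t)) x₀ (R₁' + speedIntegral u t / c)
    have h3 := sphereNormSq_nonneg (FluidPDE.curl (u t)) x₀ (R₂' - speedIntegral u t / c)
    have hk2 : 0 ≤ k / 2 := by positivity
    have hkR : 0 ≤ k / R₁' := by positivity
    exact add_nonneg (mul_nonneg hk2 (add_nonneg (mul_nonneg (sq_nonneg _) h2)
      (mul_nonneg (sq_nonneg _) h3))) (mul_nonneg hkR h1)
  -- the initial bound W(0) ≤ δ²/2 ≤ K₁ δ²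
  have hW0K : (fun s => localisedEnstrophy (movingCutoff x₀ k (fun t => R₁' + speedIntegral u t / c) (fun t => R₂' - speedIntegral u t / c) s) (u s)) 0 ≤ K₁ * δ ^ 2 := by
    have hS : MeasurableSet (Metric.ball x₀ R₂ \ Metric.ball x₀ R₁) :=
      measurableSet_ball.diff measurableSet_ball
    have hsub : Metric.ball x₀ (R₂' - speedIntegral u 0 / c) \
        Metric.closedBall x₀ (R₁' + speedIntegral u 0 / c) ⊆ Metric.ball x₀ R₂ \ Metric.ball x₀ R₁ := by
      intro x hx
      rw [hσ00, zero_div, sub_zero, add_zero] at hx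
      rw [Set.mem_sdiff, Metric.mem_ball, Metric.mem_closedBall, not_le] at hx
      rw [Set.mem_sdiff, Metric.mem_ball, Metric.mem_ball, not_lt]
      exact ⟨hx.1.trans_le hR₂'mem.2, hR₁'mem.1.trans hx.2.le⟩
    have h := localisedEnstrophy_movingCutoff_le_of_setLIntegral_le (x₀ := x₀) (k := k)
      (ρ₁ := fun t => R₁' + speedIntegral u t / c) (ρ₂ := fun t => R₂' - speedIntegral u t / c)
      hk0.le (t := 0) hS hsub (v := u 0) (sq_nonneg δ) hω₀
    have h2 : δ ^ 2 / 2 ≤ K₁ * δ ^ 2 := by nlinarith [sq_nonneg δ]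
    exact h.trans h2
  -- the heat-flux budget ∫₀ᵀ b ≤ K₁ δ²
  have hIb : ∫ t in (0)..T, (fun s => k / 2 * ((R₁' + speedIntegral u s / c) ^ 2 *
            sphereNormSq (FluidPDE.curl (u s)) x₀ (R₁' + speedIntegral u s / c) +
            (R₂' - speedIntegral u s / c) ^ 2 *
              sphereNormSq (FluidPDE.curl (u s)) x₀ (R₂' - speedIntegral u s / c)) +
          k / R₁' * ∫ x in {x : EuclideanSpace ℝ (Fin 3) | R₁' < ‖x - x₀‖ ∧ ‖x - x₀‖ < R₂'},
            ‖FluidPDE.curl (u s) x‖ ^ 2) t ≤ K₁ * δ ^ 2 := by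
    have hs₁ := continuousOn_sq_mul_sphereNormSq_curl hT hu x₀ hρ₁c
    have hs₂ := continuousOn_sq_mul_sphereNormSq_curl hT hu x₀ hρ₂c
    have hsh := continuousOn_setIntegral_shell_curl_sq hT hu x₀ (a := R₁') (b := R₂') hR₁'.le
    have i₁ := hs₁.intervalIntegrable_of_Icc (μ := volume) hT.le
    have i₂ := hs₂.intervalIntegrable_of_Icc (μ := volume) hT.le
    have ish := hsh.intervalIntegrable_of_Icc (μ := volume) hT.le
    have hsplit : ∫ t in (0)..T, (fun s => k / 2 * ((R₁' + speedIntegral u s / c) ^ 2 *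
            sphereNormSq (FluidPDE.curl (u s)) x₀ (R₁' + speedIntegral u s / c) +
            (R₂' - speedIntegral u s / c) ^ 2 *
              sphereNormSq (FluidPDE.curl (u s)) x₀ (R₂' - speedIntegral u s / c)) +
          k / R₁' * ∫ x in {x : EuclideanSpace ℝ (Fin 3) | R₁' < ‖x - x₀‖ ∧ ‖x - x₀‖ < R₂'},
            ‖FluidPDE.curl (u s) x‖ ^ 2) t =
        k / 2 * ((∫ t in (0)..T, (R₁' + speedIntegral u t / c) ^ 2 *
            sphereNormSq (FluidPDE.curl (u t)) x₀ (R₁' + speedIntegral u t / c)) +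
          ∫ t in (0)..T, (R₂' - speedIntegral u t / c) ^ 2 *
            sphereNormSq (FluidPDE.curl (u t)) x₀ (R₂' - speedIntegral u t / c)) +
        k / R₁' * ∫ t in (0)..T, ∫ x in {x : EuclideanSpace ℝ (Fin 3) | R₁' < ‖x - x₀‖ ∧ ‖x - x₀‖ < R₂'},
            ‖FluidPDE.curl (u t) x‖ ^ 2 := by
      simp only []
      rw [intervalIntegral.integral_add ((i₁.add i₂).const_mul _) (ish.const_mul _),
        intervalIntegral.integral_const_mul, intervalIntegral.integral_const_mul,
        intervalIntegral.integral_add i₁ i₂]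
    have hshT := intervalIntegral_setIntegral_shell_curl_sq_le hT hu hE hD' x₀ (a := R₁') (b := R₂') hR₁'.le
    rw [hsplit]
    -- arithmetic
    have hkε : k * ε = K₁ * δ ^ 2 / 4 := by rw [hεdef]; field_simp
    have hR₁'2r : 2 * r < R₁' := by linarith [hR₁'mem.1]
    have h1 : k / R₁' * ∫ t in (0)..T, ∫ x in {x : EuclideanSpace ℝ (Fin 3) | R₁' < ‖x - x₀‖ ∧ ‖x - x₀‖ < R₂'},
        ‖FluidPDE.curl (u t) x‖ ^ 2 ≤ k / (2 * r) * (κ2 * E) := by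
      have ha : k / R₁' ≤ k / (2 * r) := div_le_div_of_nonneg_left hk0.le (by positivity) hR₁'2r.le
      have hI0 : 0 ≤ ∫ t in (0)..T, ∫ x in {x : EuclideanSpace ℝ (Fin 3) | R₁' < ‖x - x₀‖ ∧ ‖x - x₀‖ < R₂'},
          ‖FluidPDE.curl (u t) x‖ ^ 2 := intervalIntegral.integral_nonneg hT.le fun t _ => hshell0 t
      calc k / R₁' * ∫ t in (0)..T, ∫ x in {x : EuclideanSpace ℝ (Fin 3) | R₁' < ‖x - x₀‖ ∧ ‖x - x₀‖ < R₂'},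
            ‖FluidPDE.curl (u t) x‖ ^ 2
          ≤ k / (2 * r) * ∫ t in (0)..T, ∫ x in {x : EuclideanSpace ℝ (Fin 3) | R₁' < ‖x - x₀‖ ∧ ‖x - x₀‖ < R₂'},
            ‖FluidPDE.curl (u t) x‖ ^ 2 := mul_le_mul_of_nonneg_right ha hI0
        _ ≤ k / (2 * r) * (κ2 * E) := mul_le_mul_of_nonneg_left hshT (by positivity)
    have h2 : k * (κ2 * E) / r ≤ δ ^ 2 / 9 := by
      rw [div_le_div_iff₀ hr (by norm_num : (0:ℝ) < 9)]
      have : 9 * c ^ (-(1 / 10 : ℝ)) * κ2 * E * δ ^ 2 ≤ r * δ ^ 2 :=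
        mul_le_mul_of_nonneg_right hEr.le (sq_nonneg δ)
      calc k * (κ2 * E) * 9 = 9 * c ^ (-(1 / 10 : ℝ)) * κ2 * E * δ ^ 2 := by rw [hk]; ring
        _ ≤ r * δ ^ 2 := this
        _ = δ ^ 2 * r := by ring
    have h3 : k / 2 * ((κ2 * E / (r / 4) + ε) + (κ2 * E / (r / 4) + ε)) + k / (2 * r) * (κ2 * E) =
        9 / 2 * (k * (κ2 * E) / r) + k * ε := by
      field_simp
      ring
    have h4 : δ ^ 2 ≤ K₁ * δ ^ 2 := le_mul_of_one_le_left (sq_nonneg δ) hK₁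
    have hmono : k / 2 * ((∫ t in (0)..T, (R₁' + speedIntegral u t / c) ^ 2 *
            sphereNormSq (FluidPDE.curl (u t)) x₀ (R₁' + speedIntegral u t / c)) +
          ∫ t in (0)..T, (R₂' - speedIntegral u t / c) ^ 2 *
            sphereNormSq (FluidPDE.curl (u t)) x₀ (R₂' - speedIntegral u t / c)) ≤
        k / 2 * ((κ2 * E / (r / 4) + ε) + (κ2 * E / (r / 4) + ε)) :=
      mul_le_mul_of_nonneg_left (add_le_add hT₁ hT₂) (by positivity)
    linarith [sq_nonneg δ]
  -- the continuity method
  obtain ⟨hWbd, hYbd⟩ := hstep hc hcc₀ hδ hT hδ4T (W := (fun s => localisedEnstrophy (movingCutoff x₀ k (fun t => R₁' + speedIntegral u t / c) (fun t => R₂' - speedIntegral u t / c) s) (u s))) (Y := (fun s => localisedEnstrophyDissipation (movingCutoff x₀ k (fun t => R₁' + speedIntegral u t / c) (fun t => R₂' - speedIntegral u t / c) s) (u s))) (a := fun s => Real.sqrt 2 * Real.sqrt (∫ x in {x : EuclideanSpace ℝ (Fin 3) |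
      R₁' < ‖x - x₀‖ ∧ ‖x - x₀‖ < R₂'}, ‖FluidPDE.curl (f s) x‖ ^ 2))
    (b := (fun s => k / 2 * ((R₁' + speedIntegral u s / c) ^ 2 *
            sphereNormSq (FluidPDE.curl (u s)) x₀ (R₁' + speedIntegral u s / c) +
            (R₂' - speedIntegral u s / c) ^ 2 *
              sphereNormSq (FluidPDE.curl (u s)) x₀ (R₂' - speedIntegral u s / c)) +
          k / R₁' * ∫ x in {x : EuclideanSpace ℝ (Fin 3) | R₁' < ‖x - x₀‖ ∧ ‖x - x₀‖ < R₂'},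
            ‖FluidPDE.curl (u s) x‖ ^ 2)) hWc hYc hac hbc hW0' hY0' ha0' hb0' hW0K
    hIa hIb (fun t ht => hineq t ht)
  -- extraction of the conclusion on the plateau annulus
  have hP : MeasurableSet (Metric.ball x₀ (R₂ - r) \ Metric.ball x₀ (R₁ + r)) :=
    measurableSet_ball.diff measurableSet_ball
  have hone : ∀ t ∈ Icc 0 T, ∀ x ∈ Metric.ball x₀ (R₂ - r) \ Metric.ball x₀ (R₁ + r),
      movingCutoff x₀ k (fun t => R₁' + speedIntegral u t / c) (fun t => R₂' - speedIntegral u t / c) t x = 1 := by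
    intro t ht x hx
    rw [Set.mem_sdiff, Metric.mem_ball, Metric.mem_ball, not_lt, dist_eq_norm] at hx
    refine movingCutoff_eq_one hk0 ?_ ?_
    · change R₁' + speedIntegral u t / c + k⁻¹ ≤ ‖x - x₀‖
      linarith [hx.2, hσcM t ht, hR₁'mem.2]
    · change ‖x - x₀‖ ≤ R₂' - speedIntegral u t / c - k⁻¹
      linarith [hx.1, hσcM t ht, hR₂'mem.1]
  refine ⟨fun t ht => ?_, ?_⟩
  · have h1 := setLIntegral_curl_sq_le_ofReal_localisedEnstrophy (v := u t) hP
      (movingCutoff_nonneg x₀ k (fun t => R₁' + speedIntegral u t / c) (fun t => R₂' - speedIntegral u t / c) t)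
      (hone t ht) (integrable_curl_sq_mul_movingCutoff hsol hk0.le ht)
    refine h1.trans (ENNReal.ofReal_le_ofReal ?_)
    rw [hA2]
    have := hWbd t ht
    nlinarith [hL6, sq_nonneg δ]
  · have h1 : ∫⁻ t in Ioo 0 T, ∫⁻ x in Metric.ball x₀ (R₂ - r) \ Metric.ball x₀ (R₁ + r),
        ‖fderiv ℝ (FluidPDE.curl (u t)) x‖ₑ ^ 2 ≤ ∫⁻ t in Ioo 0 T, ENNReal.ofReal ((fun s => localisedEnstrophyDissipation (movingCutoff x₀ k (fun t => R₁' + speedIntegral u t / c) (fun t => R₂' - speedIntegral u t / c) s) (u s)) t) := by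
      refine setLIntegral_mono' measurableSet_Ioo fun t ht => ?_
      exact setLIntegral_fderiv_curl_sq_le_ofReal_dissipation (v := u t) hP
        (movingCutoff_nonneg x₀ k _ _ t) (hone t (Ioo_subset_Icc_self ht))
        (integrable_fderiv_curl_sq_mul_movingCutoff hsol hk0.le (Ioo_subset_Icc_self ht))
    refine h1.trans ?_
    have hYi : IntegrableOn (fun s => localisedEnstrophyDissipation (movingCutoff x₀ k (fun t => R₁' + speedIntegral u t / c) (fun t => R₂' - speedIntegral u t / c) s) (u s)) (Ioo 0 T) volume :=
      (hYc.integrableOn_compact isCompact_Icc).mono_set Ioo_subset_Icc_self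
    have hnn : 0 ≤ᵐ[volume.restrict (Ioo 0 T)] (fun s => localisedEnstrophyDissipation (movingCutoff x₀ k (fun t => R₁' + speedIntegral u t / c) (fun t => R₂' - speedIntegral u t / c) s) (u s)) :=
      (ae_restrict_iff' measurableSet_Ioo).2 (Eventually.of_forall fun t ht => hY0' t (Ioo_subset_Icc_self ht))
    rw [← ofReal_integral_eq_lintegral_ofReal hYi hnn, ← integral_Ioc_eq_integral_Ioo,
      ← intervalIntegral.integral_of_le hT.le]
    refine ENNReal.ofReal_le_ofReal ?_
    rw [hA2]
    exact hYbd


end Assembly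

/-! ## Remark 10.6, second step WITH force: annulus ⇒ exterior region -/

/-- **Tao 2011, Thm. 10.1, exterior form (Remark 10.6), a priori, unit viscosity, WITH FORCE.**
For a classical solution of the forced `ν = 1` system on `[0,T] × ℝ³` with `sup_t ∫|u|² ≤ 2E`,
`∫₀ᵀ∫|∇u|² ≤ E`, `∫₀ᵀ‖u‖_{L^∞} ≤ M`, and a ball `B(x₀,R)` with
`‖ω₀‖_{L²(ℝ³ ∖ B(x₀,R))} ≤ δ` and `‖∇ × f‖_{L¹_t L²_x([0,T] × (ℝ³ ∖ B(x₀,R)))} ≤ δ` ((10.1),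
inverted), under `δ⁴T + δ⁵E^{1/2}T ≤ c` and `C(E + M + δ⁻²) < r < R/2`:
`sup_t ‖ω(t)‖²_{L²(ℝ³ ∖ B(x₀,R+r))} ≤ (Aδ)²` and `∫₀ᵀ‖∇ω‖²_{L²(ℝ³ ∖ B(x₀,R+r))} ≤ (Aδ)²`. From the
annular form by monotone convergence over `B(x₀,R+r+n+1) ∖ B(x₀,R+r)`, exactly as the tree's
`tao2011_enstrophyLocalisation_exterior_apriori_unit_of_annulus` (`f = 0`).
[cite: Tao2011, Thm. 10.1 + Remark 10.6 (arXiv Thm. 59, Rem. 64)] -/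
theorem enstrophyLocalisation_exterior_apriori_unit_forced (hY : tao2011_nonlinearEstimate) :
    ∃ c C A : ℝ, 0 < c ∧ 0 < C ∧ 0 < A ∧
    ∀ ⦃T : ℝ⦄ (_hT : 0 < T) ⦃f u : ℝ → EuclideanSpace ℝ (Fin 3) → EuclideanSpace ℝ (Fin 3)⦄
      ⦃p : ℝ → EuclideanSpace ℝ (Fin 3) → ℝ⦄
      (_hsol : FluidPDE.IsClassicalNSSolutionOn (Icc 0 T) 1 f u p)
      ⦃E M : ℝ⦄ (_hE : 0 ≤ E) (_hM : 0 ≤ M)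
      (_hEt : ∀ t ∈ Icc 0 T, ∫⁻ x, ‖u t x‖ₑ ^ 2 ≤ ENNReal.ofReal (2 * E))
      (_hD : ENNReal.ofReal 1 *
          ∫⁻ t in Ioo 0 T, ∫⁻ x, ENNReal.ofReal (FluidPDE.frobeniusNormSq (fderiv ℝ (u t) x)) ≤
        ENNReal.ofReal E)
      (_hMt : ∫⁻ t in Ioo 0 T, eLpNorm (u t) ∞ volume ≤ ENNReal.ofReal M)
      (x₀ : EuclideanSpace ℝ (Fin 3)) ⦃R r δ : ℝ⦄ (_hδ : 0 < δ) (_hr : 0 < r) (_hrR : r < R / 2)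
      (_hω₀ : ∫⁻ x in (Metric.ball x₀ R)ᶜ, ‖FluidPDE.curl (u 0) x‖ₑ ^ 2 ≤ ENNReal.ofReal (δ ^ 2))
      (_hF : ∫⁻ t in Ioo 0 T, (∫⁻ x in (Metric.ball x₀ R)ᶜ,
          ‖FluidPDE.curl (f t) x‖ₑ ^ 2) ^ (1 / 2 : ℝ) ≤ ENNReal.ofReal δ)
      (_hsmall : δ ^ 4 * T + δ ^ 5 * Real.sqrt E * T ≤ c)
      (_hlarge : C * (E + M + δ⁻¹ ^ 2) < r),
      (∀ t ∈ Icc 0 T, ∫⁻ x in (Metric.ball x₀ (R + r))ᶜ, ‖FluidPDE.curl (u t) x‖ₑ ^ 2 ≤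
          ENNReal.ofReal ((A * δ) ^ 2)) ∧
        ∫⁻ t in Ioo 0 T, ∫⁻ x in (Metric.ball x₀ (R + r))ᶜ,
            ‖fderiv ℝ (FluidPDE.curl (u t)) x‖ₑ ^ 2 ≤ ENNReal.ofReal ((A * δ) ^ 2) := by
  obtain ⟨c, C, A, hc, hC, hA, hmain⟩ := enstrophyLocalisation_annulus_apriori_unit_forced hY
  refine ⟨c, C, A, hc, hC, hA, ?_⟩
  intro T hT f u p hsol E M hE hM hEt hD hMt x₀ R r δ hδ hr hrR hω₀ hF hsmall hlarge
  -- the exhausting annuli `Sₙ = B(x₀, R + r + n + 1) \ B(x₀, R + r)`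
  obtain ⟨S, hS⟩ : ∃ S : ℕ → Set (EuclideanSpace ℝ (Fin 3)),
      S = fun n : ℕ => Metric.ball x₀ (R + r + ((n : ℝ) + 1)) \ Metric.ball x₀ (R + r) :=
    ⟨_, rfl⟩
  have hSmono : Monotone S := by
    intro m n hmn x hx
    rw [hS] at hx ⊢
    refine ⟨?_, hx.2⟩
    have hmn' : (m : ℝ) ≤ n := by exact_mod_cast hmn
    exact Metric.ball_subset_ball (by linarith) hx.1
  have hSdir : Directed (· ⊆ ·) S := fun m n =>
    ⟨max m n, hSmono (le_max_left m n), hSmono (le_max_right m n)⟩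
  have hSU : (⋃ n, S n) = (Metric.ball x₀ (R + r))ᶜ := by
    ext x
    simp only [hS, mem_iUnion, Set.mem_sdiff, Metric.mem_ball, mem_compl_iff]
    constructor
    · rintro ⟨n, -, hx⟩
      exact hx
    · intro hx
      obtain ⟨n, hn⟩ := exists_nat_gt (dist x x₀ - (R + r))
      refine ⟨n, ?_, hx⟩
      linarith
  -- the annular theorem on `B(x₀, R + 2r + n + 1) \ B(x₀, R)`
  have hball : ∀ n : ℕ,
      (∀ t ∈ Icc 0 T, ∫⁻ x in S n, ‖FluidPDE.curl (u t) x‖ₑ ^ 2 ≤ ENNReal.ofReal ((A * δ) ^ 2)) ∧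
        ∫⁻ t in Ioo 0 T, ∫⁻ x in S n, ‖fderiv ℝ (FluidPDE.curl (u t)) x‖ₑ ^ 2 ≤
          ENNReal.ofReal ((A * δ) ^ 2) := by
    intro n
    have hn0 : (0 : ℝ) ≤ n := n.cast_nonneg
    have hrR₂ : r < (R + 2 * r + (n + 1) - R) / 2 := by linarith
    have hω₀' : ∫⁻ x in Metric.ball x₀ (R + 2 * r + (n + 1)) \ Metric.ball x₀ R,
        ‖FluidPDE.curl (u 0) x‖ₑ ^ 2 ≤ ENNReal.ofReal (δ ^ 2) :=
      (lintegral_mono_set fun x hx => hx.2).trans hω₀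
    have hF' : ∫⁻ t in Ioo 0 T, (∫⁻ x in Metric.ball x₀ (R + 2 * r + (n + 1)) \ Metric.ball x₀ R,
        ‖FluidPDE.curl (f t) x‖ₑ ^ 2) ^ (1 / 2 : ℝ) ≤ ENNReal.ofReal δ :=
      (lintegral_mono fun t => ENNReal.rpow_le_rpow (lintegral_mono_set fun x hx => hx.2)
        (by norm_num)).trans hF
    have key := hmain hT hsol hE hM hEt hD hMt x₀ hδ hr hrR hrR₂ hω₀' hF' hsmall hlarge
    have e : R + 2 * r + ((n : ℝ) + 1) - r = R + r + (n + 1) := by ring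
    rw [e] at key
    rw [hS]
    exact key
  refine ⟨fun t ht => ?_, ?_⟩
  · -- monotone convergence in `x`
    rw [← hSU, setLIntegral_iUnion_of_directed _ hSdir]
    exact iSup_le fun n => (hball n).1 t ht
  · -- monotone convergence in `x` for each `t`, then in `t`
    have hF2 : ∀ t, ∫⁻ x in (Metric.ball x₀ (R + r))ᶜ, ‖fderiv ℝ (FluidPDE.curl (u t)) x‖ₑ ^ 2 =
        ⨆ n, ∫⁻ x in S n, ‖fderiv ℝ (FluidPDE.curl (u t)) x‖ₑ ^ 2 := fun t => by
      rw [← hSU, setLIntegral_iUnion_of_directed _ hSdir]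
    simp_rw [hF2]
    rw [lintegral_iSup' (fun n => aemeasurable_setLIntegral_fderiv_curl hT hsol (S n))
      (ae_of_all _ fun t m n hmn => lintegral_mono_set (hSmono hmn))]
    exact iSup_le fun n => (hball n).2

end Literature.Analysis.FluidPDE

end
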